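import Literature.IUT.HodgeTheaters.GlobalFrobenioidsCoricRigidityFieldLevel
import Literature.AnabelianGeometry.AbsoluteAnabelian.AbsTopIII.KummerFaithfulDivisibleOverNumberField
import HarnessLib

/-!
# [IUTchI] Example 5.1 (v), field-level closers: the Kummer-injectivity law (iv) `hdiv` DISCHARGED from
# finite generation of the fixed fields over `ℚ` (PROOF-ONLY)

Mochizuki, *Inter-universal Teichmüller theory I*, §5, Example 5.1 (v), kurims manuscript (May 2020) p. 127
l. 57–79 (cell render lit/IUTchI-EX51v-VERBATIM.md of the kurims PDF, `cat -n` numbering) ([IUTchI] Ex 5.1 (v) p.127)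
[claim: Mochizuki2012, status: disputed]: "On the other hand, consideration of Kummer classes [i.e., of the action
of `π₁^{κ-sol}(†𝒟^⊛)` (respectively, `π₁^rat(†𝒟^⊛)`) on `N`-th roots of elements, for positive integers `N`] yields
a natural injection of `†𝕄^⊛_∞κ` (respectively, `†𝕄^⊛_∞κ×`) into `lim_{→H} H¹(H, μ_Ẑ(†𝕄^⊛_∞κ))` (respectively,
`lim_{→H} H¹(H, μ_Ẑ(†𝕄^⊛_∞κ×))`) — where `H` ranges over the open subgroups of `π₁^{κ-sol}(†𝒟^⊛)` (respectively,
`π₁^rat(†𝒟^⊛)`), and we observe that the asserted injectivity follows immediately from the corresponding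
injectivity in the case of `𝕄^⊛_∞κ(†𝒟^⊚)` (respectively, `𝕄^⊛_∞κ×(†𝒟^⊚)`)."; and (i) p. 123 l. 52–58
(lit/IUTchI-EX51-i-iv-vii-VERBATIM.md): "we conclude that we may construct group-theoretically from `π₁(†𝒟^⊚)`,
in a functorial fashion, an isomorph `π₁^rat(†𝒟^⊛) (↠ π₁(†𝒟^⊛))` of the absolute Galois group of the function
field of `C_{F_mod}`".

STATE OF THE TREE.  abc-iut-w4-d056's FIELD-LEVEL closers of E51/L29
(`NFBridgeRecon.existsUniqueCoricStructure_infκPair_fieldLevel` / `…_infκxPair_fieldLevel`,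
`GlobalFrobenioidsCoricRigidityFieldLevel.lean`, p436822) derive `ExistsUniqueCoricStructure π₁^rat 𝕄^⊛_∞κ(×)`
from elementary hypotheses on the datum `N : NFBridgeRecon`, among them the LAW

  (iv) `hdiv : ∀ (H : OpenNormalSubgroup π₁^rat) (a : K_rat), a ≠ 0 → (H fixes a) →
          (∀ n ≥ 1, ∃ b, H fixes b ∧ b ^ n = a) → a = 1`

("no `H`-invariant nonzero rational function other than `1` has `H`-invariant `n`-th roots for all `n`" = the
Kummer injectivity E51/L26 at the finite levels), recorded by w4-d056 as the "RESIDUAL at the genuine model: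
(iv) `⋂ₙ (K_Hˣ)ⁿ = 1` for function fields over number fields" (GAP-LEDGER G-w4d056-2, 7th disposition) and
shown INDEPENDENT of the other hypotheses at non-finitely-generated data (p443335, tightness).

THIS FILE (PROOF-ONLY: no `def`, no `instance`, no `structure`; nothing of anybody's file is edited or restated;
abc-iut-w4-d050 gen 5) DISCHARGES (iv) from a STRUCTURAL property of the datum — the one the genuine
`π₁^rat = Gal(L̄_C/L_C)`, `K_rat = L̄_C` has by (i) p. 123 (the fixed field of an open normal subgroup is a finite
extension of the function field `L_C` of the curve `C_{F_mod}` over the number field `F_mod`, hence finitely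
generated over `ℚ`):

  `hfg : ∀ H : OpenNormalSubgroup π₁^rat, ∃ s : Finset K_rat, every H-fixed a ∈ K_rat lies in ℚ(s)`,

using the tree's THEOREMS [AbsTopIII] Rmk. 1.5.4 (i) "number fields are Kummer-faithful"
(`isKummerFaithful_of_numberField`, abc-iut-f-070/083/085) and (ii) "finitely generated extensions of torally
Kummer-faithful fields are torally Kummer-faithful" (`Rmk_1_5_4_ii_holds`, abc-iut-L4-t17), composed in
`KummerFaithfulDivisibleOverNumberField.lean` (`eq_one_of_fixed_of_forall_exists_fixed_pow_eq`):

* `NFBridgeRecon.charZero_krat_of_hprim` — the closers' hypothesis `hprim` (primitive roots of unity of every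
  order in `K_rat`) already forces `char K_rat = 0`;
* `NFBridgeRecon.hdiv_of_fixed_subset_adjoin_finset` — `hfg` (+ `char K_rat = 0`) ⟹ (iv) `hdiv` VERBATIM;
* `NFBridgeRecon.existsUniqueCoricStructure_infκPair_fieldLevel_of_fg` / `…_infκxPair_fieldLevel_of_fg` —
  w4-d056's two closers with the law (iv) REPLACED by the structural `hfg` (all other binders verbatim).

HONEST LABEL: a binder reduction (law → structure + classical theorem); nothing here constructs the genuine
datum, asserts any statement of [IUTchI], or takes a side on [IUTchIII] Cor. 3.12; typed ≠ proved.  (v2: doc-only — the two quotations above made verbatim, pre-empting an M19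
referee flag; no declaration changed.)
-/

namespace Literature.IUT.HodgeTheaters

namespace NFBridgeRecon

open IntermediateField
open Literature.AnabelianGeometry.AbsoluteAnabelian.AbsTopIII

variable (N : NFBridgeRecon.{0})

/-- The closers' hypothesis `hprim` ("`K_rat` has primitive `n`-th roots of unity for every `n ≥ 1`") forces
`char K_rat = 0` (a primitive `n`-th root of unity in a domain makes `n` invertible, Mathlib
`IsPrimitiveRoot.neZero'`). ([IUTchI] Ex 5.1 (v) p.127) [claim: Mochizuki2012, status: disputed] -/
theorem charZero_krat_of_hprim (hprim : ∀ n : ℕ, 0 < n → ∃ ζ : N.Krat, IsPrimitiveRoot ζ n) :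
    CharZero N.Krat := by
  refine charZero_of_inj_zero fun n hn => ?_
  by_contra hne
  haveI : NeZero n := ⟨hne⟩
  obtain ⟨ζ, hζ⟩ := hprim n (Nat.pos_of_ne_zero hne)
  exact (hζ.neZero').out hn

/-- **Law (iv) `hdiv` from finite generation of the fixed fields.**  If `char K_rat = 0` and, for every open
normal subgroup `H ⊆ π₁^rat(†𝒟^⊛)`, the `H`-fixed rational functions lie in a subfield `ℚ(s)` generated by a
FINITE set `s` (at the genuine datum: `K_rat^H` is a finite extension of the function field of `C_{F_mod}`,
(i) p. 123), then an `H`-fixed `a ≠ 0` admitting `H`-fixed `n`-th roots for every `n ≥ 1` equals `1` — the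
hypothesis `hdiv` of `existsUniqueCoricStructure_infκPair_fieldLevel` VERBATIM ([AbsTopIII] Rmk. 1.5.4
(i)(ii): finitely generated fields over number fields are torally Kummer-faithful).
([IUTchI] Ex 5.1 (v) p.127) [claim: Mochizuki2012, status: disputed] -/
theorem hdiv_of_fixed_subset_adjoin_finset [CharZero N.Krat]
    (hfg : ∀ H : OpenNormalSubgroup N.piRat, ∃ s : Finset N.Krat,
      ∀ a : N.Krat, (∀ h : N.piRat, h ∈ H → h • a = a) → a ∈ adjoin ℚ (s : Set N.Krat)) :
    ∀ (H : OpenNormalSubgroup N.piRat) (a : N.Krat), a ≠ 0 → (∀ h : N.piRat, h ∈ H → h • a = a) →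
      (∀ n : ℕ+, ∃ b : N.Krat, (∀ h : N.piRat, h ∈ H → h • b = b) ∧ b ^ (n : ℕ) = a) → a = 1 := by
  intro H a ha hfix hroots
  obtain ⟨s, hs⟩ := hfg H
  exact eq_one_of_fixed_of_forall_exists_fixed_pow_eq (H : Subgroup N.piRat) s
    (fun a' ha' => hs a' fun h hh => ha' h hh) ha (fun h hh => hfix h hh)
    (fun n => by
      obtain ⟨b, hb, hba⟩ := hroots n
      exact ⟨b, fun h hh => hb h hh, hba⟩)

/-- **[IUTchI] Ex. 5.1 (v), ∞κ — FIELD-LEVEL FORM with (iv) DISCHARGED**: abc-iut-w4-d056's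
`existsUniqueCoricStructure_infκPair_fieldLevel` with the Kummer-injectivity LAW `hdiv` replaced by the
STRUCTURAL hypothesis `hfg` (fixed fields of open normal subgroups finitely generated over `ℚ`) over
`[CharZero K_rat]` (which `hprim` forces anyway: `charZero_krat_of_hprim`).  All other binders (`hroot`, `hprim`, `h1`, `hpow`, `ord`/`hordmul`, Rmk 3.1.7 (i)/(ii)
`hpole`/`hex`) verbatim. ([IUTchI] Ex 5.1 (v) p.128) [claim: Mochizuki2012, status: disputed] -/
theorem existsUniqueCoricStructure_infκPair_fieldLevel_of_fg [CharZero N.Krat]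
    (hroot : ∀ a : N.Krat, a ≠ 0 → ∀ n : ℕ, 0 < n → ∃ b : N.Krat, b ^ n = a)
    (hprim : ∀ n : ℕ, 0 < n → ∃ ζ : N.Krat, IsPrimitiveRoot ζ n)
    (h1 : (1 : N.Krat) ∈ N.Minfκ) (hpow : ∀ (f : N.Krat) (n : ℕ), 0 < n → (f ∈ N.Minfκ ↔ f ^ n ∈ N.Minfκ))
    (hfg : ∀ H : OpenNormalSubgroup N.piRat, ∃ s : Finset N.Krat,
      ∀ a : N.Krat, (∀ h : N.piRat, h ∈ H → h • a = a) → a ∈ adjoin ℚ (s : Set N.Krat))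
    {X : Type*} (ord : X → N.Krat → ℤ)
    (hordmul : ∀ (x : X) (a b : N.Krat), a ≠ 0 → b ≠ 0 → (∀ g : N.piRat, g • a = a) → (∀ g : N.piRat, g • b = b) →
      ord x (a * b) = ord x a + ord x b)
    (hpole : ∀ f' ∈ N.Minfκ, (∀ g : N.piRat, g • f' = f') →
      ∀ x₁ x₂ : X, x₁ ≠ x₂ → ¬ (ord x₁ f' < 0 ∧ ord x₂ f' < 0))
    (hex : ∃ f ∈ N.Minfκ, (∀ g : N.piRat, g • f = f) ∧
      ∃ x₁ x₂ : X, x₁ ≠ x₂ ∧ 0 < ord x₁ f ∧ 0 < ord x₂ f) :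
    ExistsUniqueCoricStructure N.piRat N.infκPair :=
  N.existsUniqueCoricStructure_infκPair_fieldLevel hroot hprim h1 hpow
    (N.hdiv_of_fixed_subset_adjoin_finset hfg) ord hordmul hpole hex

/-- **[IUTchI] Ex. 5.1 (v), "respectively, ∞κ×" — FIELD-LEVEL FORM with (iv) DISCHARGED**: the twin of
`existsUniqueCoricStructure_infκPair_fieldLevel_of_fg` for `𝕄^⊛_∞κ×(†𝒟^⊚)`.
([IUTchI] Ex 5.1 (v) p.128) [claim: Mochizuki2012, status: disputed] -/
theorem existsUniqueCoricStructure_infκxPair_fieldLevel_of_fg [CharZero N.Krat]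
    (hroot : ∀ a : N.Krat, a ≠ 0 → ∀ n : ℕ, 0 < n → ∃ b : N.Krat, b ^ n = a)
    (hprim : ∀ n : ℕ, 0 < n → ∃ ζ : N.Krat, IsPrimitiveRoot ζ n)
    (h1 : (1 : N.Krat) ∈ N.Minfκx) (hpow : ∀ (f : N.Krat) (n : ℕ), 0 < n → (f ∈ N.Minfκx ↔ f ^ n ∈ N.Minfκx))
    (hfg : ∀ H : OpenNormalSubgroup N.piRat, ∃ s : Finset N.Krat,
      ∀ a : N.Krat, (∀ h : N.piRat, h ∈ H → h • a = a) → a ∈ adjoin ℚ (s : Set N.Krat))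
    {X : Type*} (ord : X → N.Krat → ℤ)
    (hordmul : ∀ (x : X) (a b : N.Krat), a ≠ 0 → b ≠ 0 → (∀ g : N.piRat, g • a = a) → (∀ g : N.piRat, g • b = b) →
      ord x (a * b) = ord x a + ord x b)
    (hpole : ∀ f' ∈ N.Minfκx, (∀ g : N.piRat, g • f' = f') →
      ∀ x₁ x₂ : X, x₁ ≠ x₂ → ¬ (ord x₁ f' < 0 ∧ ord x₂ f' < 0))
    (hex : ∃ f ∈ N.Minfκx, (∀ g : N.piRat, g • f = f) ∧
      ∃ x₁ x₂ : X, x₁ ≠ x₂ ∧ 0 < ord x₁ f ∧ 0 < ord x₂ f) :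
    ExistsUniqueCoricStructure N.piRat N.infκxPair :=
  N.existsUniqueCoricStructure_infκxPair_fieldLevel hroot hprim h1 hpow
    (N.hdiv_of_fixed_subset_adjoin_finset hfg) ord hordmul hpole hex

end NFBridgeRecon

end Literature.IUT.HodgeTheaters
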